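import Summits.BirchSwinnertonDyer.BirchSwinnertonDyer.Theorems.GoldfeldK12AdditiveTwoInertSevenKrizLi7TwistTwists
import Summits.BirchSwinnertonDyer.BirchSwinnertonDyer.Theorems.GoldfeldK12AdditiveTwoInertSevenKrizLi7TwistMember113
import Summits.BirchSwinnertonDyer.BirchSwinnertonDyer.Theorems.GoldfeldK12AdditiveTwoInertSevenKrizLi7TwistMember470
import HarnessLib

set_option linter.dupNamespace false -- namespace `…BirchSwinnertonDyer.BirchSwinnertonDyer…` is the cell's (D-0017 nested layout)
set_option autoImplicit false

/-!
# K12₂″, the 7-INERT half — cone sequel II: «D(113)», «D(470)» and the inert LEAF at `ℚ(√−113)`, `ℚ(√−470)` outright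

Cell `bsd-goldfeld`, seat `bsd-goldfeld-s1p-c201` (prover, gen 9); `--supports` stmt-BirchSwinnertonDyer-20044 (K12₂″; registered stub
`stub_inertHalfGenusNonTorsion` of skeleton v7.4). Sequel of `…KrizLi7TwistTwists` (p497051/p498324: T2″ «D(n)» via the sign law, members
`n = 1, 2, 22, 29, 53`; that file is at its line cap) for the two later members: `n = 113` (p498819, first inert-half prime ≡ 1 (8)) and
`n = 470` (this gen, the EVEN-Ш member of planner ruling (lvii)(1): census `#Ш_an = 4`, `Ш(W)[2] ≅ (ℤ/2)²` — numerics only). For each: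
«D(n)» `ord_{s=1} L(W′, s) = 1` for EVERY elliptic `W′ ≅ 49a1^{(−n)}` (model-free, no Selmer hypothesis; sign law + class theorem C) and the
conclusion of the inert `L`-form leaf `X049KLevelTwoConverseInertSeven` at `K = ℚ(√−n)` outright (`analyticRankEK cm7 K = 1`, `d_K = −4n`).
Print binders: KL19 Thm. 1.20 (`h120`), Modularity (`hnf`), CLTZ Thm. 1.2 at `R = 1` (`h12`), Gross–Zagier (`hGZ`), Heegner rationality
(`hHP`). HONEST FRAMING: `p = 7`, RANK axis; witness members; nothing about `p = 2`; K12₂″ stays OPEN; BSD is not proved by any of this.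
THEOREMS ONLY. PARTITION: none — RANK axis (S1⁺); inert half of the additive cell.

References: [KrizLi2019] Thm. 1.20, Rem. 1.21; [CoatesLiTianZhai2015] Thm. 1.2; [GrossZagier1986] I.(6.3), I.§7; [MurtyMurty1997] Ch. 6 §1.
-/

noncomputable section

open scoped Classical NumberTheorySymbols

open NumberField WeierstrassCurve DirichletCharacter
open Literature.NumberTheory.EllipticCurves Literature.NumberTheory.EllipticCurves.Rank1Residual
open Literature.NumberTheory.EllipticCurves.KrizLi2019 Literature.NumberTheory.LFunctions
open Literature.NumberTheory.EllipticCurves.ModularForms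
open Literature.NumberTheory.QuadraticFields
open Summit.BirchSwinnertonDyer.Rank1Residual
open Summit.BirchSwinnertonDyer.Rank1Residual.X12.O11.RouteU

namespace Summit.BirchSwinnertonDyer.BirchSwinnertonDyer.Theorems.GoldfeldGoodTwists

/-- **«D(113)»: `ord_{s=1} L(W′, s) = 1` for every elliptic `W′ ≅ 49a1^{(−113)}`** (first inert-half prime ≡ 1 (8), `N = 784·113²`; `7` inert in `ℚ(√−113)`), from KL19 Thm. 1.20 for the twist
over `ℚ(√−31)` with the certificates `norm_generalizedBernoulli_theta1/2_n113`; no Selmer hypothesis.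
[cite: KrizLi2019, Thm. 1.20 (pp. 7–8) and Rem. 1.21] [cite: GrossZagier1986, I.(6.3) and I.§7] -/
theorem analyticRank_eq_one_twist_cm7_neg113_of_thm120
    (h120 : KrizLi2019.thm120_padicLogHeegner_unit_of_bernoulli) (hnf : exists_isNewformOf)
    (h12 : CoatesLiTianZhai2015.thm12_fullBSD_twist)
    (hGZ : ∀ (N : ℕ) [NeZero N] (V : WeierstrassCurve ℚ) (L : Type) [Field L] [NumberField L], gross_zagier N V L)
    (hHP : ∀ (V : WeierstrassCurve ℚ) (L : Type) [Field L] [NumberField L], exists_isHeegnerPoint V L)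
    (W' : WeierstrassCurve ℚ) [W'.IsElliptic] (C' : VariableChange ℚ)
    (hW' : C' • W' = cm7.quadraticTwist ((-((113 : ℕ) : ℤ) : ℤ) : ℚ)) : W'.analyticRank = 1 :=
  analyticRank_eq_one_of_smul_eq_twist_cm7_neg_of_thm120 (n := 113) (r := 31) (hr := ⟨by norm_num⟩)
    (by norm_num) (show Nat.Prime 113 by norm_num).squarefree (by norm_num) (by norm_num) (by norm_num) (by norm_num)
    (by rw [legendreSym_eq_ite 7 (by norm_num)]; decide)
    (fun q hq hqn _ => by rw [(Nat.prime_dvd_prime_iff_eq hq (by norm_num : Nat.Prime 113)).mp hqn, jacobiSym_prime_eq_ite 113 (by norm_num) (by norm_num)]; decide)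
    norm_generalizedBernoulli_theta1_n113 norm_generalizedBernoulli_theta2_n113 h120 hnf h12 hGZ hHP W' C' hW'

/-- **The inert leaf at `K = ℚ(√−113)` (`d_K = −452`, `7` inert): `ord_{s=1} L(X₀(49)/ℚ(√−113), s) = 1`**, no Selmer hypothesis —
the conclusion of `X049KLevelTwoConverseInertSeven` at this `K` outright. [cite: CoatesLiTianZhai2015, Thm. 1.2] [cite: KrizLi2019, Thm. 1.20 (pp. 7–8)] -/
theorem analyticRankEK_cm7_eq_one_discr_neg452_of_thm120
    (h120 : KrizLi2019.thm120_padicLogHeegner_unit_of_bernoulli) (hnf : exists_isNewformOf)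
    (h12 : CoatesLiTianZhai2015.thm12_fullBSD_twist)
    (hGZ : ∀ (N : ℕ) [NeZero N] (V : WeierstrassCurve ℚ) (L : Type) [Field L] [NumberField L], gross_zagier N V L)
    (hHP : ∀ (V : WeierstrassCurve ℚ) (L : Type) [Field L] [NumberField L], exists_isHeegnerPoint V L)
    (K : Type) [Field K] [NumberField K] (hdK : NumberField.discr K = -452) : analyticRankEK cm7 K = 1 :=
  analyticRankEK_cm7_eq_one_of_thm120_twist (n := 113) (r := 31) (hr := ⟨by norm_num⟩)
    (by norm_num) (show Nat.Prime 113 by norm_num).squarefree (by norm_num) (by norm_num) (by norm_num) (by norm_num)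
    (by rw [legendreSym_eq_ite 7 (by norm_num)]; decide)
    (fun q hq hqn _ => by rw [(Nat.prime_dvd_prime_iff_eq hq (by norm_num : Nat.Prime 113)).mp hqn, jacobiSym_prime_eq_ite 113 (by norm_num) (by norm_num)]; decide)
    norm_generalizedBernoulli_theta1_n113 norm_generalizedBernoulli_theta2_n113 h120 hnf h12 hGZ hHP K (by rw [hdK]; norm_num)

/-- **«D(470)»: `ord_{s=1} L(W′, s) = 1` for every elliptic `W′ ≅ 49a1^{(−470)}`** (the EVEN-Ш member `470 = 2·5·47`, `N = 3136·235²`; `7` inert in `ℚ(√−470)`), from KL19 Thm. 1.20 for the twist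
over `ℚ(√−31)` with the certificates `norm_generalizedBernoulli_theta1/2_n470`; no Selmer hypothesis.
[cite: KrizLi2019, Thm. 1.20 (pp. 7–8) and Rem. 1.21] [cite: GrossZagier1986, I.(6.3) and I.§7] -/
theorem analyticRank_eq_one_twist_cm7_neg470_of_thm120
    (h120 : KrizLi2019.thm120_padicLogHeegner_unit_of_bernoulli) (hnf : exists_isNewformOf)
    (h12 : CoatesLiTianZhai2015.thm12_fullBSD_twist)
    (hGZ : ∀ (N : ℕ) [NeZero N] (V : WeierstrassCurve ℚ) (L : Type) [Field L] [NumberField L], gross_zagier N V L)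
    (hHP : ∀ (V : WeierstrassCurve ℚ) (L : Type) [Field L] [NumberField L], exists_isHeegnerPoint V L)
    (W' : WeierstrassCurve ℚ) [W'.IsElliptic] (C' : VariableChange ℚ)
    (hW' : C' • W' = cm7.quadraticTwist ((-((470 : ℕ) : ℤ) : ℤ) : ℚ)) : W'.analyticRank = 1 :=
  analyticRank_eq_one_of_smul_eq_twist_cm7_neg_of_thm120 (n := 470) (r := 31) (hr := ⟨by norm_num⟩)
    (by norm_num) squarefree_fourHundredSeventy (by norm_num) (by norm_num) (by norm_num) (by norm_num)
    (by rw [legendreSym_eq_ite 7 (by norm_num)]; decide)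
    (fun q hq hqn hq2 => by
      have hq' : q ∣ 2 * 5 * 47 := by simpa using hqn
      rcases (Nat.Prime.dvd_mul hq).mp hq' with h | h
      · rcases (Nat.Prime.dvd_mul hq).mp h with h2 | h5
        · exact absurd ((Nat.prime_dvd_prime_iff_eq hq Nat.prime_two).mp h2) hq2
        · rw [(Nat.prime_dvd_prime_iff_eq hq (by norm_num : Nat.Prime 5)).mp h5, jacobiSym_prime_eq_ite 5 (by norm_num) (by norm_num)]
          decide
      · rw [(Nat.prime_dvd_prime_iff_eq hq (by norm_num : Nat.Prime 47)).mp h, jacobiSym_prime_eq_ite 47 (by norm_num) (by norm_num)]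
        decide)
    norm_generalizedBernoulli_theta1_n470 norm_generalizedBernoulli_theta2_n470 h120 hnf h12 hGZ hHP W' C' hW'

/-- **The inert leaf at `K = ℚ(√−470)` (`d_K = −1880`, `7` inert): `ord_{s=1} L(X₀(49)/ℚ(√−470), s) = 1`**, no Selmer hypothesis —
the conclusion of `X049KLevelTwoConverseInertSeven` at this `K` outright. [cite: CoatesLiTianZhai2015, Thm. 1.2] [cite: KrizLi2019, Thm. 1.20 (pp. 7–8)] -/
theorem analyticRankEK_cm7_eq_one_discr_neg1880_of_thm120
    (h120 : KrizLi2019.thm120_padicLogHeegner_unit_of_bernoulli) (hnf : exists_isNewformOf)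
    (h12 : CoatesLiTianZhai2015.thm12_fullBSD_twist)
    (hGZ : ∀ (N : ℕ) [NeZero N] (V : WeierstrassCurve ℚ) (L : Type) [Field L] [NumberField L], gross_zagier N V L)
    (hHP : ∀ (V : WeierstrassCurve ℚ) (L : Type) [Field L] [NumberField L], exists_isHeegnerPoint V L)
    (K : Type) [Field K] [NumberField K] (hdK : NumberField.discr K = -1880) : analyticRankEK cm7 K = 1 :=
  analyticRankEK_cm7_eq_one_of_thm120_twist (n := 470) (r := 31) (hr := ⟨by norm_num⟩)
    (by norm_num) squarefree_fourHundredSeventy (by norm_num) (by norm_num) (by norm_num) (by norm_num)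
    (by rw [legendreSym_eq_ite 7 (by norm_num)]; decide)
    (fun q hq hqn hq2 => by
      have hq' : q ∣ 2 * 5 * 47 := by simpa using hqn
      rcases (Nat.Prime.dvd_mul hq).mp hq' with h | h
      · rcases (Nat.Prime.dvd_mul hq).mp h with h2 | h5
        · exact absurd ((Nat.prime_dvd_prime_iff_eq hq Nat.prime_two).mp h2) hq2
        · rw [(Nat.prime_dvd_prime_iff_eq hq (by norm_num : Nat.Prime 5)).mp h5, jacobiSym_prime_eq_ite 5 (by norm_num) (by norm_num)]
          decide
      · rw [(Nat.prime_dvd_prime_iff_eq hq (by norm_num : Nat.Prime 47)).mp h, jacobiSym_prime_eq_ite 47 (by norm_num) (by norm_num)]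
        decide)
    norm_generalizedBernoulli_theta1_n470 norm_generalizedBernoulli_theta2_n470 h120 hnf h12 hGZ hHP K (by rw [hdK]; norm_num)
end Summit.BirchSwinnertonDyer.BirchSwinnertonDyer.Theorems.GoldfeldGoodTwists

end
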